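import Summits.BirchSwinnertonDyer.BirchSwinnertonDyer.Theorems.GoldfeldAllTwistsTwoConverseTwinAdditiveSplitPrimeTwistSelmer
import Summits.BirchSwinnertonDyer.BirchSwinnertonDyer.Theorems.GoldfeldAllTwistsTwoConverseTwinGenusDescentRankZero
import Summits.BirchSwinnertonDyer.BirchSwinnertonDyer.Theorems.BiquadraticEisensteinDescentHeegnerTwistCouplingInSupplyQuarticTwistDescentDual
import Mathlib.NumberTheory.LegendreSymbol.QuadraticReciprocity
import HarnessLib

set_option linter.dupNamespace false -- `Summit.BirchSwinnertonDyer.BirchSwinnertonDyer.Theorems.…` (summit = sub)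
set_option autoImplicit false

/-!
# Crux `HeegnerTwistCouplingInSupply` (stmt-BirchSwinnertonDyer-21381) — the `j = −3375` family `A_n : y² = x³ + 21n x² + 112n² x`
# (`= X₀(49)^{(n)}`, CM by `ℤ[(1+√−7)/2]`): LOCAL LEMMAS for the `2`-isogeny descent on CELL-√7 (`n = q·m`, `q ≡ 3 (mod 8)` prime
# inert in `ℚ(√−7)`, `m` square-free with prime factors `≡ 1 (mod 4)` inert in `ℚ(√−7)`) — UNCONDITIONAL

Route `BiquadraticEisensteinDescent` (cell `pub/bsd-wall`, width seat `bsd-wall-cm-bed-w1` g11; `--supports` 21381, helper). Part I of the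
`j = −3375` corner (sequel `…SqrtSevenCell`: the Selmer sets, rank, `Ш[2]`, corank; `…SqrtSevenCorner`: the crux conclusion for
`W = X₀(49)^{(−p)}`, `p ≡ 3, 19, 27 (mod 56)`). The quartics are those of the tree's PROVED descent via two-isogeny (`twoIsogenyQuartic a d d′`:
`w² = d u⁴ + a u²z² + d′ z⁴`, AEC X.4.9) for `(a, b) = (21n, 112n²)` and `(−2a, a² − 4b) = (−42n, −7n²)`; the engine lemmas are the
`bsd-goldfeld` cell's (`not_isSoluble_padic_of_prime_dvd_coeffs`, `not_isSoluble_two_of_zmodPow`), which treated the NEGATIVE twists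
`49a1^{(−m)}`; here the symbols and residues needed for the POSITIVE twists with ONE prime factor `q ≡ 3 (mod 8)`:

* §1 symbols: `(7/q) = +1`, `(−7/q) = (2/q) = (14/q) = −1` for a prime `q ≡ 3 (mod 8)` with `(q/7) = −1`; `(7/r) = (−7/r) = −1` for a prime
  `r ≡ 1 (mod 4)` with `(r/7) = −1`; the non-residues `−1, −c², qc²` modulo `7`;
* §2 the `2`-adic residues (modulo `32`, `decide`) killing the classes `−q`, `7q` of `S(−42n, −7n²)` (`m ≡ 1 (mod 4)`);
* §3 the `r`-adic deaths of the classes through a prime `r ∣ n` (reduced discriminants `−7(n/r)²` resp. `7·(16 n/r)²`) and the bookkeeping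
  of square-free integers supported on `{2, 7}` resp. `{7, q}`.

HONEST FRAMING: local arithmetic only; nothing about Selmer groups, ranks, `L`-values, the crux or BSD is asserted here. THEOREMS ONLY.
-/

noncomputable section

open scoped Classical

namespace Summit.BirchSwinnertonDyer.BirchSwinnertonDyer.Theorems.BiquadraticEisensteinDescentHeegnerTwistCouplingInSupplySqrtSevenLocal

open _root_.WeierstrassCurve Literature.NumberTheory.EllipticCurves
open Summit.BirchSwinnertonDyer.BirchSwinnertonDyer.Theorems.GoldfeldGoodTwists
  (not_isSoluble_two_of_zmodPow not_isSoluble_padic_of_prime_dvd_coeffs)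
open Summit.BirchSwinnertonDyer.BirchSwinnertonDyer.Theorems.BiquadraticEisensteinDescentHeegnerTwistCouplingInSupplyQuarticTwistDescentDual
  (not_isSquare_two_mod_q)

/-! ## §1 Symbols -/

section Symbols

/-- A non-square times a unit square is a non-square modulo a prime. [folklore] -/
theorem not_isSquare_mul_sq {r : ℕ} [Fact r.Prime] {x c : ℤ} (hx : ¬ IsSquare ((x : ℤ) : ZMod r))
    (hc : ¬ (r : ℤ) ∣ c) : ¬ IsSquare ((x * c ^ 2 : ℤ) : ZMod r) := by
  rintro ⟨y, hy⟩
  have hc0 : (c : ZMod r) ≠ 0 := by rwa [Ne, ZMod.intCast_zmod_eq_zero_iff_dvd]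
  refine hx ⟨y / c, ?_⟩
  have : ((x * c ^ 2 : ℤ) : ZMod r) = (x : ZMod r) * (c : ZMod r) ^ 2 := by push_cast; ring
  rw [this] at hy
  field_simp
  linear_combination hy

/-- A non-zero square times a non-square is a non-square modulo a prime. [folklore] -/
theorem not_isSquare_mul_of_isSquare {r : ℕ} [Fact r.Prime] {x y : ℤ} (hx : IsSquare ((x : ℤ) : ZMod r))
    (hx0 : ((x : ℤ) : ZMod r) ≠ 0) (hy : ¬ IsSquare ((y : ℤ) : ZMod r)) : ¬ IsSquare ((x * y : ℤ) : ZMod r) := by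
  rintro ⟨s, hs⟩
  obtain ⟨t, ht⟩ := hx
  have ht0 : t ≠ 0 := by rintro rfl; exact hx0 (by simpa using ht)
  refine hy ⟨s / t, ?_⟩
  push_cast at hs
  field_simp
  linear_combination hs - (y : ZMod r) * ht

/-- The non-residues `3, 5, 6` and `−1` modulo `7`. [folklore] -/
theorem zmod_seven_nonresidues : ∀ r : ZMod 7, r * r ≠ 3 ∧ r * r ≠ 5 ∧ r * r ≠ 6 ∧ r * r ≠ -1 := by decide

/-- `(q/7) = −1` as non-squareness: `q ≡ 3, 5, 6 (mod 7)` is not a square modulo `7`. [folklore] -/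
theorem not_isSquare_zmod_seven {q : ℕ} (hq7 : q % 7 = 3 ∨ q % 7 = 5 ∨ q % 7 = 6) :
    ¬ IsSquare ((q : ℤ) : ZMod 7) := by
  rintro ⟨r, hr⟩
  have hcast : ((q : ℤ) : ZMod 7) = ((q % 7 : ℕ) : ZMod 7) := by
    rw [Int.cast_natCast, ← ZMod.natCast_mod q 7]
  rw [hcast] at hr
  rcases hq7 with h | h | h <;> rw [h] at hr <;> norm_num at hr
  · exact (zmod_seven_nonresidues r).1 hr.symm
  · exact (zmod_seven_nonresidues r).2.1 hr.symm
  · exact (zmod_seven_nonresidues r).2.2.1 hr.symm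

/-- `−c²` (`7 ∤ c`) is a non-residue modulo `7`. [folklore] -/
theorem not_isSquare_neg_sq_zmod_seven {c : ℤ} (hc : ¬ (7 : ℤ) ∣ c) : ¬ IsSquare ((-(c ^ 2) : ℤ) : ZMod 7) := by
  haveI : Fact (Nat.Prime 7) := ⟨by norm_num⟩
  have h := not_isSquare_mul_sq (r := 7) (x := -1) (c := c)
    (by rintro ⟨r, hr⟩; exact (zmod_seven_nonresidues r).2.2.2 (by rw [← hr]; push_cast; ring)) (by exact_mod_cast hc)
  rwa [show (-1 * c ^ 2 : ℤ) = -(c ^ 2) by ring] at h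

/-- `q c²` (`(q/7) = −1`, `7 ∤ c`) is a non-residue modulo `7`. [folklore] -/
theorem not_isSquare_mul_sq_zmod_seven {q : ℕ} (hq7 : q % 7 = 3 ∨ q % 7 = 5 ∨ q % 7 = 6) {c : ℤ} (hc : ¬ (7 : ℤ) ∣ c) :
    ¬ IsSquare (((q : ℤ) * c ^ 2 : ℤ) : ZMod 7) := by
  haveI : Fact (Nat.Prime 7) := ⟨by norm_num⟩
  exact not_isSquare_mul_sq (r := 7) (not_isSquare_zmod_seven hq7) (by exact_mod_cast hc)

/-- `legendreSym 7 q = −1` for `q ≡ 3, 5, 6 (mod 7)`. [folklore] -/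
theorem legendreSym_seven_eq_neg_one {q : ℕ} (hq7 : q % 7 = 3 ∨ q % 7 = 5 ∨ q % 7 = 6) :
    @legendreSym 7 ⟨by norm_num⟩ q = -1 := by
  haveI : Fact (Nat.Prime 7) := ⟨by norm_num⟩
  exact (legendreSym.eq_neg_one_iff 7).mpr (not_isSquare_zmod_seven hq7)

variable {q : ℕ} [Fact q.Prime]

/-- For a prime `q ≡ 3 (mod 4)` inert in `ℚ(√−7)`: `7` IS a square modulo `q` (`(7/q) = −(q/7) = +1`). [cite: IrelandRosen1990, Ch. 5 §2 Thm. 1] -/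
theorem isSquare_seven_of_mod_four_eq_three (hq4 : q % 4 = 3) (hq7 : q % 7 = 3 ∨ q % 7 = 5 ∨ q % 7 = 6) :
    IsSquare ((7 : ℤ) : ZMod q) ∧ ((7 : ℤ) : ZMod q) ≠ 0 := by
  haveI : Fact (Nat.Prime 7) := ⟨by norm_num⟩
  have hq : q.Prime := Fact.out
  have hne : q ≠ 7 := by rintro rfl; omega
  have h70 : ((7 : ℤ) : ZMod q) ≠ 0 := by
    intro h
    have h' : ((7 : ℕ) : ZMod q) = 0 := by exact_mod_cast h
    rw [ZMod.natCast_eq_zero_iff] at h'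
    exact hne ((Nat.prime_dvd_prime_iff_eq hq (by norm_num)).mp h')
  have hrec := legendreSym.quadratic_reciprocity_three_mod_four (p := q) (q := 7) hq4 (by norm_num)
  rw [legendreSym_seven_eq_neg_one hq7] at hrec
  have h1 : legendreSym q 7 = 1 := by
    have := hrec; push_cast at this ⊢; linarith
  exact ⟨(legendreSym.eq_one_iff q h70).mp h1, h70⟩

/-- For a prime `q ≡ 3 (mod 4)` inert in `ℚ(√−7)`: `−7` is a non-residue modulo `q`. [cite: IrelandRosen1990, Ch. 5 §2 Thm. 1] -/
theorem not_isSquare_neg_seven_of_mod_four_eq_three (hq4 : q % 4 = 3) (hq7 : q % 7 = 3 ∨ q % 7 = 5 ∨ q % 7 = 6) :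
    ¬ IsSquare ((-7 : ℤ) : ZMod q) := by
  have hq2 : q ≠ 2 := by rintro rfl; omega
  obtain ⟨h7, h70⟩ := isSquare_seven_of_mod_four_eq_three hq4 hq7
  rw [← legendreSym.eq_neg_one_iff]
  rw [show (-7 : ℤ) = -1 * 7 by norm_num, legendreSym.mul, legendreSym.at_neg_one hq2, ZMod.χ₄_nat_three_mod_four hq4,
    (legendreSym.eq_one_iff q h70).mpr h7]
  norm_num

/-- `14` is a non-residue modulo a prime `q ≡ 3 (mod 8)` inert in `ℚ(√−7)` (`(2/q) = −1` — the tree's `not_isSquare_two_mod_q` of the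
quartic corner — and `(7/q) = +1`). [folklore] -/
theorem not_isSquare_fourteen (hq8 : q % 8 = 3) (hq7 : q % 7 = 3 ∨ q % 7 = 5 ∨ q % 7 = 6) :
    ¬ IsSquare ((14 : ℤ) : ZMod q) := by
  obtain ⟨h7, h70⟩ := isSquare_seven_of_mod_four_eq_three (by omega) hq7
  have := not_isSquare_mul_of_isSquare h7 h70 (not_isSquare_two_mod_q hq8)
  simpa using this

variable {r : ℕ} [Fact r.Prime]

/-- For a prime `r ≡ 1 (mod 4)` inert in `ℚ(√−7)`: `7` and `−7` are non-residues modulo `r` (`(7/r) = (r/7) = −1`, `(−1/r) = 1`).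
[cite: IrelandRosen1990, Ch. 5 §2 Thm. 1] -/
theorem not_isSquare_seven_and_neg_seven_of_mod_four_eq_one (hr4 : r % 4 = 1) (hr7 : r % 7 = 3 ∨ r % 7 = 5 ∨ r % 7 = 6) :
    ¬ IsSquare ((7 : ℤ) : ZMod r) ∧ ¬ IsSquare ((-7 : ℤ) : ZMod r) := by
  haveI : Fact (Nat.Prime 7) := ⟨by norm_num⟩
  have hr2 : r ≠ 2 := by rintro rfl; omega
  have hrec := legendreSym.quadratic_reciprocity_one_mod_four (p := r) (q := 7) hr4 (by norm_num)
  rw [legendreSym_seven_eq_neg_one hr7] at hrec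
  have h7 : legendreSym r 7 = -1 := by exact_mod_cast hrec.symm
  refine ⟨(legendreSym.eq_neg_one_iff r).mp h7, (legendreSym.eq_neg_one_iff r).mp ?_⟩
  rw [show (-7 : ℤ) = -1 * 7 by norm_num, legendreSym.mul, legendreSym.at_neg_one hr2, ZMod.χ₄_nat_one_mod_four hr4, h7]
  norm_num

end Symbols

/-! ## §2 The `2`-adic residues of the classes `−q`, `7q` of `S(−42n, −7n²)`, `n = q m`, `q ≡ 3 (mod 8)`, `m ≡ 1 (mod 4)` -/

section TwoAdic

/-- Residues modulo `32` for the class `−q` (`w² = −q u⁴ − 42qm u²z² + 7qm² z⁴`): both charts insoluble for every `q ≡ 3 (mod 8)`,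
`m ≡ 1 (mod 4)` (the residues of `q`, `m` modulo `32` are listed). [folklore] -/
theorem zmod_key_neg_q : ∀ qv mv : ZMod (2 ^ 5), (qv = 3 ∨ qv = 11 ∨ qv = 19 ∨ qv = 27) →
    (mv = 1 ∨ mv = 5 ∨ mv = 9 ∨ mv = 13 ∨ mv = 17 ∨ mv = 21 ∨ mv = 25 ∨ mv = 29) → ∀ T S : ZMod (2 ^ 5),
      S ^ 2 ≠ -qv + -(42 * qv * mv) * T ^ 2 + 7 * qv * mv ^ 2 * T ^ 4 ∧
      S ^ 2 ≠ 7 * qv * mv ^ 2 + -(42 * qv * mv) * T ^ 2 + -qv * T ^ 4 := by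
  decide +kernel

/-- Residues modulo `32` for the class `7q` (`w² = 7q u⁴ − 42qm u²z² − qm² z⁴`). [folklore] -/
theorem zmod_key_seven_q : ∀ qv mv : ZMod (2 ^ 5), (qv = 3 ∨ qv = 11 ∨ qv = 19 ∨ qv = 27) →
    (mv = 1 ∨ mv = 5 ∨ mv = 9 ∨ mv = 13 ∨ mv = 17 ∨ mv = 21 ∨ mv = 25 ∨ mv = 29) → ∀ T S : ZMod (2 ^ 5),
      S ^ 2 ≠ 7 * qv + -(42 * qv * mv) * T ^ 2 + -(qv * mv ^ 2) * T ^ 4 ∧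
      S ^ 2 ≠ -(qv * mv ^ 2) + -(42 * qv * mv) * T ^ 2 + 7 * qv * T ^ 4 := by
  decide +kernel

/-- The residue of `q ≡ 3 (mod 8)` modulo `32`. [folklore] -/
theorem cast_zmod32_of_mod_eight_eq_three {q : ℕ} (hq8 : q % 8 = 3) :
    (q : ZMod (2 ^ 5)) = 3 ∨ (q : ZMod (2 ^ 5)) = 11 ∨ (q : ZMod (2 ^ 5)) = 19 ∨ (q : ZMod (2 ^ 5)) = 27 := by
  have h : (q : ZMod (2 ^ 5)) = ((q % 32 : ℕ) : ZMod (2 ^ 5)) := (ZMod.natCast_mod q (2 ^ 5)).symm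
  have h32 : q % 32 = 3 ∨ q % 32 = 11 ∨ q % 32 = 19 ∨ q % 32 = 27 := by omega
  rcases h32 with h' | h' | h' | h' <;> rw [h, h'] <;> decide

/-- The residue of `m ≡ 1 (mod 4)` modulo `32`. [folklore] -/
theorem cast_zmod32_of_mod_four_eq_one {m : ℕ} (hm4 : m % 4 = 1) :
    (m : ZMod (2 ^ 5)) = 1 ∨ (m : ZMod (2 ^ 5)) = 5 ∨ (m : ZMod (2 ^ 5)) = 9 ∨ (m : ZMod (2 ^ 5)) = 13 ∨
      (m : ZMod (2 ^ 5)) = 17 ∨ (m : ZMod (2 ^ 5)) = 21 ∨ (m : ZMod (2 ^ 5)) = 25 ∨ (m : ZMod (2 ^ 5)) = 29 := by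
  have h : (m : ZMod (2 ^ 5)) = ((m % 32 : ℕ) : ZMod (2 ^ 5)) := (ZMod.natCast_mod m (2 ^ 5)).symm
  have h32 : m % 32 = 1 ∨ m % 32 = 5 ∨ m % 32 = 9 ∨ m % 32 = 13 ∨ m % 32 = 17 ∨ m % 32 = 21 ∨ m % 32 = 25 ∨ m % 32 = 29 := by
    omega
  rcases h32 with h' | h' | h' | h' | h' | h' | h' | h' <;> rw [h, h'] <;> decide

variable {q m : ℕ}

/-- The class `−q` of `S(−42qm, −7q²m²)` has no `ℚ₂`-point (`q ≡ 3 (mod 8)`, `m ≡ 1 (mod 4)`). [cite: SilvermanAEC2009, Prop. X.4.9] -/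
theorem not_isSoluble_two_neg_q (hq8 : q % 8 = 3) (hm4 : m % 4 = 1) :
    ¬ ((twoIsogenyQuartic (-42 * ((q * m : ℕ) : ℤ)) (-(q : ℤ)) (7 * q * (m : ℤ) ^ 2)).map (Int.castRingHom ℚ_[2])).IsSoluble := by
  have key := fun T S => zmod_key_neg_q _ _ (cast_zmod32_of_mod_eight_eq_three hq8) (cast_zmod32_of_mod_four_eq_one hm4) T S
  refine not_isSoluble_two_of_zmodPow 5 5 (fun T S => ?_) (fun T S => ?_)
  · have := (key T S).1; push_cast; convert this using 2 <;> ring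
  · have := (key T S).2; push_cast; convert this using 2 <;> ring

/-- The class `7q` of `S(−42qm, −7q²m²)` has no `ℚ₂`-point (`q ≡ 3 (mod 8)`, `m ≡ 1 (mod 4)`). [cite: SilvermanAEC2009, Prop. X.4.9] -/
theorem not_isSoluble_two_seven_q (hq8 : q % 8 = 3) (hm4 : m % 4 = 1) :
    ¬ ((twoIsogenyQuartic (-42 * ((q * m : ℕ) : ℤ)) (7 * (q : ℤ)) (-((q : ℤ) * (m : ℤ) ^ 2))).map
      (Int.castRingHom ℚ_[2])).IsSoluble := by
  have key := fun T S => zmod_key_seven_q _ _ (cast_zmod32_of_mod_eight_eq_three hq8) (cast_zmod32_of_mod_four_eq_one hm4) T S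
  refine not_isSoluble_two_of_zmodPow 5 5 (fun T S => ?_) (fun T S => ?_)
  · have := (key T S).1; push_cast; convert this using 2 <;> ring
  · have := (key T S).2; push_cast; convert this using 2 <;> ring

end TwoAdic

/-! ## §3 `r`-adic deaths of the classes through a prime of `n`; square-free bookkeeping -/

section Radic

variable {q m : ℕ}

/-- A square-free positive natural number all of whose prime factors are `≡ 1 (mod 4)` is `≡ 1 (mod 4)`. [folklore] -/
theorem mod_four_eq_one_of_prime_factors {m : ℕ} (hm0 : 0 < m)
    (hm : ∀ r : ℕ, r.Prime → r ∣ m → r % 4 = 1) : m % 4 = 1 := by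
  induction m using induction_on_primes with
  | zero => omega
  | one => rfl
  | prime_mul r k hr ih =>
    have hk0 : 0 < k := Nat.pos_of_ne_zero (by rintro rfl; omega)
    have h1 : r % 4 = 1 := hm r hr (dvd_mul_right r k)
    have h2 : k % 4 = 1 := ih hk0 (fun r' hr' hd => hm r' hr' (dvd_mul_of_dvd_right hd r))
    rw [Nat.mul_mod, h1, h2]

/-- The cell hypotheses on `n = q m` packaged: `q ≡ 3 (mod 8)` prime with `(q/7) = −1`, `m ≥ 1` square-free, `q ∤ m`, every prime factor
`r` of `m` with `r ≡ 1 (mod 4)` and `(r/7) = −1`. Consequences used below: `n` is square-free, `7 ∤ n`, `m ≡ 1 (mod 4)`. [folklore] -/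
theorem cell_facts (hq : q.Prime) (hq8 : q % 8 = 3) (hm0 : 0 < m)
    (hmsq : Squarefree m) (hqm : ¬ q ∣ m)
    (hm : ∀ r : ℕ, r.Prime → r ∣ m → r % 4 = 1 ∧ (r % 7 = 3 ∨ r % 7 = 5 ∨ r % 7 = 6)) :
    Squarefree (q * m) ∧ ¬ 7 ∣ q * m ∧ m % 4 = 1 ∧ 0 < q * m := by
  refine ⟨?_, ?_, mod_four_eq_one_of_prime_factors hm0 fun r hr hd => (hm r hr hd).1, Nat.mul_pos hq.pos hm0⟩
  · rw [Nat.squarefree_mul ((Nat.Prime.coprime_iff_not_dvd hq).mpr hqm)]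
    exact ⟨hq.squarefree, hmsq⟩
  · intro h7
    rcases (Nat.Prime.dvd_mul (by norm_num : Nat.Prime 7)).mp h7 with h | h
    · have := (Nat.prime_dvd_prime_iff_eq (by norm_num) hq).mp h; omega
    · have := (hm 7 (by norm_num) h).2; omega

/-- **The odd part of `S(21n, 112n²)`: a class through a prime `r ∣ n` dies at `r`.** With `n = r n₁`, `d = r e`, all three
coefficients of `w² = d u⁴ + 21n u²z² + (112n²/d) z⁴` are divisible by `r` and the reduced discriminant is `−7 n₁²`, a non-residue for
every prime of the cell (`(−7/r) = (r/7) = −1`). [cite: SilvermanAEC2009, Prop. X.4.9] -/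
theorem not_isSoluble_padic_phiHat_of_prime_dvd {n r : ℕ} [Fact r.Prime] (hnsq : Squarefree n) (hrn : r ∣ n)
    (h7 : ¬ IsSquare ((-7 : ℤ) : ZMod r)) {d : ℤ} (hd : Squarefree d) (hrd : (r : ℤ) ∣ d) (hdb : d ∣ 112 * (n : ℤ) ^ 2) :
    ¬ ((twoIsogenyQuartic (21 * (n : ℤ)) d (112 * (n : ℤ) ^ 2 / d)).map (Int.castRingHom ℚ_[r])).IsSoluble := by
  have hr : r.Prime := Fact.out
  have hrZ : Prime (r : ℤ) := Nat.prime_iff_prime_int.mp hr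
  obtain ⟨n₁, rfl⟩ := hrn
  obtain ⟨e, rfl⟩ := hrd
  have hrn₁ : ¬ (r : ℤ) ∣ n₁ := fun h => hrZ.not_unit ((Int.squarefree_natCast.mpr hnsq) r ⟨n₁ / r, by
    obtain ⟨k, hk⟩ := h; push_cast; rw [hk, Int.mul_ediv_cancel_left _ hrZ.ne_zero]; ring⟩)
  have hre : ¬ (r : ℤ) ∣ e := fun h => hrZ.not_unit (hd r ⟨e / r, by
    obtain ⟨k, rfl⟩ := h; rw [Int.mul_ediv_cancel_left _ hrZ.ne_zero]; ring⟩)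
  -- complementary divisor `e' = 112 n² / d` is `r e₁` with `e e₁ = 112 n₁²`
  set d' : ℤ := 112 * ((r * n₁ : ℕ) : ℤ) ^ 2 / (r * e) with hd'
  have hdd' : r * e * d' = 112 * ((r * n₁ : ℕ) : ℤ) ^ 2 := Int.mul_ediv_cancel' hdb
  have hre' : (r : ℤ) ∣ e * d' := ⟨112 * n₁ ^ 2, mul_left_cancel₀ hrZ.ne_zero (by push_cast at hdd' ⊢; linear_combination hdd')⟩
  obtain ⟨e₁, he₁⟩ : (r : ℤ) ∣ d' := (hrZ.dvd_or_dvd hre').resolve_left hre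
  have hee : e * e₁ = 112 * (n₁ : ℤ) ^ 2 := by
    have := hdd'; rw [he₁] at this; push_cast at this
    exact mul_left_cancel₀ (pow_ne_zero 2 hrZ.ne_zero) (by linear_combination this)
  refine not_isSoluble_padic_of_prime_dvd_coeffs (c := 21 * n₁) (by push_cast; ring) rfl he₁ hee ?_
  rw [show ((21 * (n₁ : ℤ)) ^ 2 - 4 * (112 * (n₁ : ℤ) ^ 2) : ℤ) = -7 * (n₁ : ℤ) ^ 2 by ring]
  exact not_isSquare_mul_sq h7 hrn₁

/-- **The odd part of `S(−42n, −7n²)` at a prime `r ∣ m`** (`r ≡ 1 (mod 4)`, `(r/7) = −1`): reduced discriminant `1792 n₁² = 7·(16n₁)²`,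
a non-residue as `(7/r) = −1`. [cite: SilvermanAEC2009, Prop. X.4.9] -/
theorem not_isSoluble_padic_phi_of_prime_dvd {n r : ℕ} [Fact r.Prime] (hr2 : r ≠ 2) (hnsq : Squarefree n) (hrn : r ∣ n)
    (h7 : ¬ IsSquare ((7 : ℤ) : ZMod r)) {d : ℤ} (hd : Squarefree d) (hrd : (r : ℤ) ∣ d) (hdb : d ∣ -7 * (n : ℤ) ^ 2) :
    ¬ ((twoIsogenyQuartic (-42 * (n : ℤ)) d (-7 * (n : ℤ) ^ 2 / d)).map (Int.castRingHom ℚ_[r])).IsSoluble := by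
  have hr : r.Prime := Fact.out
  have hrZ : Prime (r : ℤ) := Nat.prime_iff_prime_int.mp hr
  obtain ⟨n₁, rfl⟩ := hrn
  obtain ⟨e, rfl⟩ := hrd
  have hrn₁ : ¬ (r : ℤ) ∣ n₁ := fun h => hrZ.not_unit ((Int.squarefree_natCast.mpr hnsq) r ⟨n₁ / r, by
    obtain ⟨k, hk⟩ := h; push_cast; rw [hk, Int.mul_ediv_cancel_left _ hrZ.ne_zero]; ring⟩)
  have hre : ¬ (r : ℤ) ∣ e := fun h => hrZ.not_unit (hd r ⟨e / r, by
    obtain ⟨k, rfl⟩ := h; rw [Int.mul_ediv_cancel_left _ hrZ.ne_zero]; ring⟩)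
  set d' : ℤ := -7 * ((r * n₁ : ℕ) : ℤ) ^ 2 / (r * e) with hd'
  have hdd' : r * e * d' = -7 * ((r * n₁ : ℕ) : ℤ) ^ 2 := Int.mul_ediv_cancel' hdb
  have hre' : (r : ℤ) ∣ e * d' := ⟨-7 * n₁ ^ 2, mul_left_cancel₀ hrZ.ne_zero (by push_cast at hdd' ⊢; linear_combination hdd')⟩
  obtain ⟨e₁, he₁⟩ : (r : ℤ) ∣ d' := (hrZ.dvd_or_dvd hre').resolve_left hre
  have hee : e * e₁ = -7 * (n₁ : ℤ) ^ 2 := by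
    have := hdd'; rw [he₁] at this; push_cast at this
    exact mul_left_cancel₀ (pow_ne_zero 2 hrZ.ne_zero) (by linear_combination this)
  refine not_isSoluble_padic_of_prime_dvd_coeffs (c := -42 * n₁) (by push_cast; ring) rfl he₁ hee ?_
  rw [show ((-42 * (n₁ : ℤ)) ^ 2 - 4 * (-7 * (n₁ : ℤ) ^ 2) : ℤ) = 7 * (16 * (n₁ : ℤ)) ^ 2 by ring]
  exact not_isSquare_mul_sq h7 (fun h => (hrZ.dvd_or_dvd h).elim
    (fun h16 => by
      have : r ∣ 16 := by exact_mod_cast h16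
      have h2 : r ∣ 2 := (Nat.Prime.dvd_of_dvd_pow hr (show r ∣ 2 ^ 4 by simpa using this))
      exact hr2 ((Nat.prime_dvd_prime_iff_eq hr Nat.prime_two).mp h2)) hrn₁)

/-- A square-free integer whose only prime factors are among `2, 7` is `±1, ±2, ±7, ±14`. [folklore] -/
theorem natAbs_mem_of_squarefree {d : ℤ} (hd : Squarefree d) (h27 : ∀ r : ℕ, r.Prime → (r : ℤ) ∣ d → r = 2 ∨ r = 7) :
    d.natAbs = 1 ∨ d.natAbs = 2 ∨ d.natAbs = 7 ∨ d.natAbs = 14 := by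
  have hd0 : d.natAbs ≠ 0 := Int.natAbs_ne_zero.mpr hd.ne_zero
  have hsq : Squarefree d.natAbs := Int.squarefree_natAbs.mpr hd
  have hdvd : d.natAbs ∣ 14 := by
    rw [← Nat.prod_primeFactors_of_squarefree hsq]
    refine (Finset.prod_primes_dvd _ (fun r hr => (Nat.prime_of_mem_primeFactors hr).prime) ?_)
    · intro r hr
      have hr := Nat.prime_of_mem_primeFactors hr
      rcases h27 r hr (Int.ofNat_dvd_left.mpr (Nat.dvd_of_mem_primeFactors ‹_›)) with rfl | rfl <;> norm_num
  have := Nat.le_of_dvd (by norm_num) hdvd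
  interval_cases h : d.natAbs <;> simp_all

/-- A square-free integer whose only prime factors are among `7, q` (`q ≠ 7` prime) is `±1, ±7, ±q, ±7q`. [folklore] -/
theorem natAbs_mem_of_squarefree_seven (hq : q.Prime) (hq7 : q ≠ 7) {d : ℤ} (hd : Squarefree d)
    (h : ∀ r : ℕ, r.Prime → (r : ℤ) ∣ d → r = 7 ∨ r = q) :
    d.natAbs = 1 ∨ d.natAbs = 7 ∨ d.natAbs = q ∨ d.natAbs = 7 * q := by
  have hsq : Squarefree d.natAbs := Int.squarefree_natAbs.mpr hd
  have hdvd : d.natAbs ∣ 7 * q := by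
    rw [← Nat.prod_primeFactors_of_squarefree hsq]
    refine Finset.prod_primes_dvd _ (fun r hr => (Nat.prime_of_mem_primeFactors hr).prime) ?_
    intro r hr
    have hr' := Nat.prime_of_mem_primeFactors hr
    rcases h r hr' (Int.ofNat_dvd_left.mpr (Nat.dvd_of_mem_primeFactors hr)) with rfl | rfl
    · exact dvd_mul_right 7 q
    · exact dvd_mul_left _ 7
  obtain ⟨a, b, ha, hb, hab⟩ := Nat.dvd_mul.mp hdvd
  rcases (Nat.dvd_prime (by norm_num)).mp ha with rfl | rfl <;>
    rcases (Nat.dvd_prime hq).mp hb with rfl | rfl <;> simp_all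

end Radic

end Summit.BirchSwinnertonDyer.BirchSwinnertonDyer.Theorems.BiquadraticEisensteinDescentHeegnerTwistCouplingInSupplySqrtSevenLocal

end
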